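import Summits.HodgeConjecture.HodgeConjecture.Theorems.Ring2WeilCoverageRamifiedTypes
import Summits.HodgeConjecture.HodgeConjecture.Theorems.Ring2WeilCoverageRamifiedPrimePowers
import Summits.HodgeConjecture.HodgeConjecture.Theorems.Ring2WeilCoverageCyclotomicSignaturesG6
import Summits.HodgeConjecture.HodgeConjecture.Theorems.Ring2WeilCoverageCyclotomicUnconditional
import HarnessLib

/-!
# Weil-type family coverage — RAMIFIED TYPES AT THE `g = 6` NO LEVELS `21` AND `28`: every `ℚ(√−3)`-balanced CM type of
# `ℚ(ζ₂₁)` carries a polarisation of type `𝔮₃` (`𝔮₃² = (3)`, degree `27`, elementary divisors `(1,1,1,3,3,3)`), every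
# `ℚ(√−7)`-balanced CM type of `ℚ(ζ₂₈)` one of type `𝔮₇` (`𝔮₇⁶ = (7)`, degree `7`, `(1,1,1,1,1,7)`); and the dichotomy
# «principal XOR ramified type» for all `2⁶` CM types at each level

research route conditional on HC_CM; not a corollary; Q11.4-sentence-2 already refuted in dim ≥ 3.

Ring 2, WEIL-TYPE FAMILY-COVERAGE CENSUS (`HOME/WEIL-FAMILY-COVERAGE.md` `## b01`, blocks b01.17 (`X₂₁ = Prim J(y² = x²¹ − 1)` on
the SPLIT `ℚ(√−3)` component with polarisation type `(1,1,1,3,3,3)`), b01.34 (the NO rows `(21, √−3)`, `(28, √−7)`: NO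
`ι`-compatible principal polarisation on `ℂ^Φ/Φ(ℤ[ζ_M])`), b01.36 (THEOREM L (ii) at 21/28); owner ring2-b01), part 49a of
the `Ring2WeilCoverage*` series.  Part 48 (`…RamifiedTypes`) reduced «`ℂ^Φ/Φ(ℤ[ζ_M])` carries a `Φ`-positive divisor of the
type `𝔣₀` with `𝔬𝔣₀ = (π)`, `π = ζ^h(1 − ζ^a)(1 − ζ^b)`» to THEOREM L (ii) + «`|S_Φ ∩ X_π|` even», `X_π = N_odd ∆ A_π` the
census's sign set twisted by the signs of `π`; part 48c gave `(1 − η)^{φ(q)}𝓞 = p𝓞` for `η` a primitive `q`-th root.  Here: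

* level `21`, `π = ζ¹⁷(1 − ζ⁷)(1 − ζ)` (`ζ⁷` a primitive cube root, `(π) = (1 − ζ⁷) = 𝔭₃`, `(π)² = (3)`):
  `twistSet_twentyOne` (`X_π = {2, 4, 11, 13, 16, 20}`, `|A_π|/2 = 3`), `map_type_pow_twentyOne` (`(𝔬𝔣₀)² = (3)`),
  **`exists_type_twentyOne_sqrt_neg_three`** / **`exists_ramifiedType_twentyOne_sqrt_neg_three`** (EVERY `ℚ(√−3)`-balanced
  `Φ`: a `Φ`-positive divisor of type `𝔣₀`, `(𝔬𝔣₀)² = (3)` — the census's NO row `(21, √−3)` = the `X₂₁` classes, which have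
  NO principal polarisation, DO have one of degree `27`), `not_exists_type_twentyOne_sqrt_neg_seven` (the YES row's types do
  not carry it), **`exists_principal_xor_type_twentyOne`** (all `64` CM types: principal XOR type `𝔣₀`);
* level `28`, `π = ζ²⁵(1 − ζ⁴)(1 − ζ²)` (`ζ⁴` a primitive 7th root, `(π) = 𝔭₇`, `(π)⁶ = (7)`): `twistSet_twentyEight`
  (`X_π = {3, 11, 15, 19, 23, 27}`), `map_type_pow_twentyEight` (`(𝔬𝔣₀)⁶ = (7)`, degree `7`),
  **`exists_type_twentyEight_sqrt_neg_seven`** / **`exists_ramifiedType_twentyEight_sqrt_neg_seven`** (the NO row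
  `(28, √−7)`), `not_exists_type_twentyEight_sqrt_neg_one`, **`exists_principal_xor_type_twentyEight`**.

The flip criterion: the verdict for the type `(π)` is the principal verdict shifted by `|A_π|/2 = #{real places where π < 0}`
(mod 2), i.e. flipped iff `N_{K⁺/ℚ}(π) < 0` — at a level with `h⁺ = 1` and `Sig(E⁺) = H` this is the Frobenius of the prime
`𝔮 = (π) ∩ K⁺` in `K/K⁺` (S-pencil, class field theory; the kernel decides `|A_π|/2` by `decide`): the primes of `K⁺` that
are INERT in `K = ℚ(ζ_M)` — here the ramified primes `𝔮₃ ∣ 3` (`M = 21`) and `𝔮₇ ∣ 7` (`M = 28`) — flip, split ones do not.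

HONEST FRAMING: torus-level statements about Shimura's divisors `X_ζ′` of type `(K; Φ; 𝔣₀)` on the principal CM torus
`ℂ^Φ/Φ(ℤ[ζ_M])` [Sh98 §14.3 Prop. 4–5] and elementary ideal arithmetic in `ℤ[ζ_M]`; all residue sets are displayed and checked
by `decide`; WHICH component of the Weil-type locus (split or not) carries the polarised point is NOT decided here — its
hermitian discriminant class is `N_{K⁺/ℚ}(𝔣₀)` times the type-independent determinant class of the torus' trace form modulo
`Nm(K^×)`, split for some types and non-split for others (b01.17, exact periods: `A₃₆`'s degree-3 type lies on the split
`ℚ(√−3)` row, its degree-8 type on `R1 = (3, ℚ(√−3), 2)`); nothing here is a statement about Hodge classes,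
`W_K`, general members or HC; `HC_CM` is used nowhere.  No `def`, no named fact, no `sorry`.

References: [cite: Shimura1998, §14.3 Prop. 4–5, pp. 103–104]; [cite: Washington1997, §8.1, Lemma 1.4, Prop. 2.8]; census
b01.17 / b01.34–b01.38 (seat-derived).
-/

noncomputable section

open Polynomial NumberField Complex Finset
open scoped Real nonZeroDivisors

namespace Summit.HodgeConjecture.Ring2WeilCoverage.RamifiedTypesLevels21and28

open Literature.AlgebraicGeometry.Motives (CMType)
open Literature.AlgebraicGeometry.HodgeTheory (IsCMTypeSet)
open Literature.AlgebraicGeometry.ComplexMultiplication.CyclotomicCMType (isCMTypeSet_residueFilter)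
open Literature.NumberTheory.ComplexMultiplication
open Summit.HodgeConjecture.Ring2WeilCoverage.RamifiedTypes
open Summit.HodgeConjecture.Ring2WeilCoverage.RamifiedPrimePowers
open Summit.HodgeConjecture.Ring2WeilCoverage.CyclotomicUnitProducts (isUnit_one_sub_toInteger_pow)
open Summit.HodgeConjecture.Ring2WeilCoverage.CMTypeSetPairCount (card_inter_add_card_inter_eq)
open Summit.HodgeConjecture.Ring2WeilCoverage.CMTypeSetOddPositions (two_mul_card_eq_card_units)
open Summit.HodgeConjecture.Ring2WeilCoverage.CyclotomicSignaturesG6 (exists_units_sign_eq_twentyOne exists_units_sign_eq_twentyEight)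
open Summit.HodgeConjecture.Ring2WeilCoverage.RealQuadraticUnitNorm (norm_realUnits_pos_twentyOne)
open Summit.HodgeConjecture.Ring2WeilCoverage.CyclotomicUnconditional (norm_realUnits_pos_twentyEight)

variable {K : Type} [Field K] [NumberField K] {ζ : K}

/-- `𝐞(t) = exp(2πi t/n) ∈ ℂ` (`ZMod.toCircle`). -/
local notation3 (prettyPrint := false) "𝐞 " t:max => ((ZMod.toCircle t : Circle) : ℂ)

section Level21

/-- the residue set `S_Φ` read at level `21`. -/
local notation3 (prettyPrint := false) "SΦ[" Φ "," z "]" =>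
  (Finset.univ.filter fun t : ZMod 21 => ∃ σ ∈ (Φ : CMType K).1, σ (z : K) = 𝐞 t)

/-- part 48's twisted sign set `X_π` at level `21` (`n := 21`). -/
local notation3 (prettyPrint := false) "Xtw21 " x:max =>
  (Finset.univ.filter fun t : ZMod 21 => t.val.Coprime 21 ∧
    ¬ ((21 < (x : ℕ × ℕ × ℕ).1 * ZMod.val t % (2 * 21) ↔ 21 < (x : ℕ × ℕ × ℕ).2.1 * ZMod.val t % (2 * 21)) ↔
      Even (Finset.card (Finset.filter (fun s : ZMod 21 => s.val.Coprime 21 ∧ s.val < t.val) Finset.univ))))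

/-- the census's `N_odd` at level `21` (part 5). -/
local notation3 (prettyPrint := false) "Nodd21" =>
  (Finset.univ.filter fun t : ZMod 21 => t.val.Coprime 21 ∧
    Even (Finset.card (Finset.filter (fun s : ZMod 21 => s.val.Coprime 21 ∧ s.val < t.val) Finset.univ)))

/-! #### Level `21`, the type `𝔣₀` with `𝔬𝔣₀ = (π)`, `π = ζ^17(1 − ζ^7)(1 − ζ^1)` (`ζ^7` a primitive `3`-th root of unity: `(π) = (1 − ζ^7)`, `(π)^2 = (3)`) -/

/-- the semi-admissibility of `x = (7, 1, 17)` at level `21` (`21 ∤ 7, 1`; `2·17 + 7 + 1 ≡ 0 (mod 42)`). [folklore] -/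
theorem adm_twentyOne : ¬ 21 ∣ ((7, 1, 17) : ℕ × ℕ × ℕ).1 ∧ ¬ 21 ∣ ((7, 1, 17) : ℕ × ℕ × ℕ).2.1 ∧
    (2 * ((7, 1, 17) : ℕ × ℕ × ℕ).2.2 + ((7, 1, 17) : ℕ × ℕ × ℕ).1 + ((7, 1, 17) : ℕ × ℕ × ℕ).2.1) % (2 * 21) = 0 := by
  decide

/-- **The twisted sign set at level `21` for `π = ζ^17(1 − ζ^7)(1 − ζ^1)`: `X_π = N_odd ∆ A_π = [2, 4, 11, 13, 16, 20]`** (`A_π = [1, 2, 8, 13, 19, 20]`, `|A_π|/2 = 3`;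
`decide`).
research route conditional on HC_CM; not a corollary; Q11.4-sentence-2 already refuted in dim ≥ 3. [folklore] -/
theorem twistSet_twentyOne : Xtw21 ((7, 1, 17) : ℕ × ℕ × ℕ) = ({2, 4, 11, 13, 16, 20} : Finset (ZMod 21)) := by
  decide

/-- **A type `𝔣₀ ⊆ 𝓞 K⁺` with `𝔬𝔣₀ = (π)`, `π = ζ^17(1 − ζ^7)(1 − ζ^1)`, EXISTS** (part 48 `exists_ideal_map_eq_span_gen`).
research route conditional on HC_CM; not a corollary; Q11.4-sentence-2 already refuted in dim ≥ 3. [cite: Shimura1998, §14.3, p. 103] -/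
theorem exists_type_ideal_twentyOne [IsCMField K] (hζ : IsPrimitiveRoot ζ 21) :
    ∃ 𝔣₀ : Ideal (𝓞 (maximalRealSubfield K)),
      𝔣₀.map (algebraMap (𝓞 (maximalRealSubfield K)) (𝓞 K)) = Ideal.span {hζ.toInteger ^ 17 * (1 - hζ.toInteger ^ 7) * (1 - hζ.toInteger ^ 1)} :=
  exists_ideal_map_eq_span_gen (x := ((7, 1, 17) : ℕ × ℕ × ℕ)) hζ adm_twentyOne

omit [NumberField K] in
/-- **`(𝔬𝔣₀)^2 = (3)`** for the type `𝔣₀` with `𝔬𝔣₀ = (π)`, `π = ζ^17(1 − ζ^7)(1 − ζ^1)`: `(π) = (1 − ζ^7)` (the factors `ζ^17`,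
`1 − ζ^1` are units, part 13) and `(1 − ζ^7)^2 = (3)` (part 48c, `ζ^7` a primitive `3`-th root of unity) — so
`N(𝔬𝔣₀) = 3^6`, `N_{K⁺/ℚ}(𝔣₀) = 3^3`: a polarisation of type `𝔣₀` on `ℂ^Φ/Φ(ℤ[ζ_21])` has degree `27`.
research route conditional on HC_CM; not a corollary; Q11.4-sentence-2 already refuted in dim ≥ 3. [cite: Washington1997, Lemma 1.4, Prop. 2.8] -/
theorem map_type_pow_twentyOne (hζ : IsPrimitiveRoot ζ 21) {𝔣₀ : Ideal (𝓞 (maximalRealSubfield K))}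
    (h𝔣₀ : 𝔣₀.map (algebraMap (𝓞 (maximalRealSubfield K)) (𝓞 K)) = Ideal.span {hζ.toInteger ^ 17 * (1 - hζ.toInteger ^ 7) * (1 - hζ.toInteger ^ 1)}) :
    𝔣₀.map (algebraMap (𝓞 (maximalRealSubfield K)) (𝓞 K)) ^ 2 = Ideal.span {(3 : 𝓞 K)} := by
  have hη : IsPrimitiveRoot (ζ ^ 7) 3 := hζ.pow (by norm_num) (by norm_num)
  have hηint : hη.toInteger = hζ.toInteger ^ 7 := RingOfIntegers.ext (by simp [IsPrimitiveRoot.toInteger])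
  have hu1 : IsUnit (hζ.toInteger ^ 17 : 𝓞 K) := (hζ.toInteger_isPrimitiveRoot.isUnit (by norm_num)).pow 17
  have hu2 : IsUnit (1 - hζ.toInteger ^ 1 : 𝓞 K) := isUnit_one_sub_toInteger_pow hζ (by decide) (by decide +kernel)
  rw [h𝔣₀, Ideal.span_singleton_mul_right_unit hu2, Ideal.span_singleton_mul_left_unit hu1, ← hηint]
  exact span_one_sub_pow_eq_three hη

open scoped Classical in
/-- **CENSUS ROW `(ℚ(ζ_21), ℚ(√−3))` (a NO row for principal polarisations) — the RAMIFIED TYPE EXISTS: for every CM type `Φ`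
of `ℚ(ζ_21)` balanced for `N_K = [2, 5, 8, 11, 17, 20]` (the Weil signature `(3,3)` on `K = ℚ(√−3)`) and every type `𝔣₀` with
`𝔬𝔣₀ = (π)`, `π = ζ^17(1 − ζ^7)(1 − ζ^1)`, the principal CM torus `ℂ^Φ/Φ(ℤ[ζ_21])` CARRIES a `Φ`-positive divisor `X_ζ′` of type
`(K; Φ; 𝔣₀)`** — `ζ′^ρ = −ζ′`, `Im φ(ζ′) > 0` on `Φ`, `IsOfType 1 ζ′ 𝔣₀` [Sh98 §14.3 Prop. 4: a polarisation whose `φ_X` is the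
`𝔬𝔣₀`-multiplication, of degree `27`].  Proof: part 48 `exists_type_of_even` + THEOREM L (ii) at `21` + the residue count
`|S_Φ ∩ X_π| ≡ |X_π ∖ N_K| + g/2 = 3 + 3 ≡ 0`.
research route conditional on HC_CM; not a corollary; Q11.4-sentence-2 already refuted in dim ≥ 3. [cite: Shimura1998, §14.3 Prop. 4–5, pp. 103–104] -/
theorem exists_type_twentyOne_sqrt_neg_three [IsCMField K] [IsCyclotomicExtension {21} ℚ K] (hζ : IsPrimitiveRoot ζ 21)
    (Φ : CMType K) (hbal : 2 * (SΦ[Φ, ζ] ∩ ({2, 5, 8, 11, 17, 20} : Finset (ZMod 21))).card = (SΦ[Φ, ζ]).card)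
    {𝔣₀ : Ideal (𝓞 (maximalRealSubfield K))}
    (h𝔣₀ : 𝔣₀.map (algebraMap (𝓞 (maximalRealSubfield K)) (𝓞 K)) = Ideal.span {hζ.toInteger ^ 17 * (1 - hζ.toInteger ^ 7) * (1 - hζ.toInteger ^ 1)}) :
    ∃ ζ' : K, IsCMField.complexConj K ζ' = -ζ' ∧ (∀ φ : Φ.1, 0 < (φ.1 ζ').im) ∧
        CMTypeLattice.IsOfType (1 : (FractionalIdeal (𝓞 K)⁰ K)ˣ) ζ' 𝔣₀ := by
  have hg : Nat.totient 21 = 2 * (5 + 1) := by decide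
  refine exists_type_of_even hζ hg adm_twentyOne Φ h𝔣₀ (exists_units_sign_eq_twentyOne hζ Φ) ?_
  rw [twistSet_twentyOne]
  have hS := isCMTypeSet_residueFilter hζ Φ
  have hX : IsCMTypeSet 21 ({2, 4, 11, 13, 16, 20} : Finset (ZMod 21)) := by decide
  have hNK : IsCMTypeSet 21 ({2, 5, 8, 11, 17, 20} : Finset (ZMod 21)) := by decide
  have h1 := card_inter_mod_two_eq hS hX hNK
  have h2 := two_mul_card_eq_card_units hS
  have hU : (Finset.univ.filter fun t : ZMod 21 => t.val.Coprime 21).card = 12 := by decide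
  have h3 : (({2, 4, 11, 13, 16, 20} : Finset (ZMod 21)) \ ({2, 5, 8, 11, 17, 20} : Finset (ZMod 21))).card = 3 := by decide
  rw [Nat.even_iff]
  omega

open scoped Classical in
/-- **CENSUS ROW `(ℚ(ζ_21), ℚ(√−3))`, headline form: there is a type `𝔣₀ ⊆ 𝓞 K⁺` with `(𝔬𝔣₀)^2 = (3)` such that
`ℂ^Φ/Φ(ℤ[ζ_21])` carries a `Φ`-positive divisor of type `(K; Φ; 𝔣₀)`** for every `K`-balanced CM type `Φ`, `K = ℚ(√−3)`
(polarisation degree `27`; the census's NO row gets an explicit NON-principal polarisation).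
research route conditional on HC_CM; not a corollary; Q11.4-sentence-2 already refuted in dim ≥ 3. [cite: Shimura1998, §14.3 Prop. 4–5, pp. 103–104] -/
theorem exists_ramifiedType_twentyOne_sqrt_neg_three [IsCMField K] [IsCyclotomicExtension {21} ℚ K]
    (hζ : IsPrimitiveRoot ζ 21) (Φ : CMType K) (hbal : 2 * (SΦ[Φ, ζ] ∩ ({2, 5, 8, 11, 17, 20} : Finset (ZMod 21))).card = (SΦ[Φ, ζ]).card) :
    ∃ 𝔣₀ : Ideal (𝓞 (maximalRealSubfield K)),
      𝔣₀.map (algebraMap (𝓞 (maximalRealSubfield K)) (𝓞 K)) ^ 2 = Ideal.span {(3 : 𝓞 K)} ∧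
      ∃ ζ' : K, IsCMField.complexConj K ζ' = -ζ' ∧ (∀ φ : Φ.1, 0 < (φ.1 ζ').im) ∧
        CMTypeLattice.IsOfType (1 : (FractionalIdeal (𝓞 K)⁰ K)ˣ) ζ' 𝔣₀ := by
  obtain ⟨𝔣₀, h𝔣₀⟩ := exists_type_ideal_twentyOne hζ
  exact ⟨𝔣₀, map_type_pow_twentyOne hζ h𝔣₀, exists_type_twentyOne_sqrt_neg_three hζ Φ hbal h𝔣₀⟩

open scoped Classical in
/-- **Row `(ℚ(ζ_21), ℚ(√−7))` (a YES row for principal polarisations) does NOT carry the ramified type**: for `Φ` balanced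
for `N_K = [5, 10, 13, 17, 19, 20]` (`K = ℚ(√−7)`) there is NO `Φ`-positive divisor of type `𝔣₀`, `𝔬𝔣₀ = (π)`, `π = ζ^17(1 − ζ^7)(1 − ζ^1)` —
THEOREM L (i) at `21` + the odd count `|S_Φ ∩ X_π| ≡ 4 + 3` (part 48 `not_exists_type_of_norm_pos_of_odd`).
research route conditional on HC_CM; not a corollary; Q11.4-sentence-2 already refuted in dim ≥ 3. [cite: Shimura1998, §14.3 Prop. 5, p. 104] -/
theorem not_exists_type_twentyOne_sqrt_neg_seven [IsCMField K] [IsCyclotomicExtension {21} ℚ K] (hζ : IsPrimitiveRoot ζ 21)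
    (Φ : CMType K) (hbal : 2 * (SΦ[Φ, ζ] ∩ ({5, 10, 13, 17, 19, 20} : Finset (ZMod 21))).card = (SΦ[Φ, ζ]).card)
    {𝔣₀ : Ideal (𝓞 (maximalRealSubfield K))}
    (h𝔣₀ : 𝔣₀.map (algebraMap (𝓞 (maximalRealSubfield K)) (𝓞 K)) = Ideal.span {hζ.toInteger ^ 17 * (1 - hζ.toInteger ^ 7) * (1 - hζ.toInteger ^ 1)}) :
    ¬ ∃ ζ' : K, IsCMField.complexConj K ζ' = -ζ' ∧ (∀ φ : Φ.1, 0 < (φ.1 ζ').im) ∧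
        CMTypeLattice.IsOfType (1 : (FractionalIdeal (𝓞 K)⁰ K)ˣ) ζ' 𝔣₀ := by
  have hg : Nat.totient 21 = 2 * (5 + 1) := by decide
  refine not_exists_type_of_norm_pos_of_odd hζ hg adm_twentyOne Φ h𝔣₀ (norm_realUnits_pos_twentyOne hζ) ?_
  rw [twistSet_twentyOne]
  have hS := isCMTypeSet_residueFilter hζ Φ
  have hX : IsCMTypeSet 21 ({2, 4, 11, 13, 16, 20} : Finset (ZMod 21)) := by decide
  have hNK : IsCMTypeSet 21 ({5, 10, 13, 17, 19, 20} : Finset (ZMod 21)) := by decide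
  have h1 := card_inter_mod_two_eq hS hX hNK
  have h2 := two_mul_card_eq_card_units hS
  have hU : (Finset.univ.filter fun t : ZMod 21 => t.val.Coprime 21).card = 12 := by decide
  have h3 : (({2, 4, 11, 13, 16, 20} : Finset (ZMod 21)) \ ({5, 10, 13, 17, 19, 20} : Finset (ZMod 21))).card = 4 := by decide
  rw [Nat.odd_iff]
  omega

open scoped Classical in
/-- **DICHOTOMY AT LEVEL `21`: every one of the `2^6` CM types `Φ` of `ℚ(ζ_21)` makes `ℂ^Φ/Φ(ℤ[ζ_21])` carry EITHER an
`ι`-compatible principal polarisation OR a `Φ`-positive divisor of the ramified type `𝔣₀` (`𝔬𝔣₀ = (π)`, `π = ζ^17(1 − ζ^7)(1 − ζ^1)`),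
NEVER BOTH** — `|N_odd ∖ X_π| = |A_π|/2 = 3` is odd (equivalently `N_{K⁺/ℚ}(π) < 0`), THEOREM L (i)/(ii) at `21`, part 48
`exists_principal_xor_exists_type`.
research route conditional on HC_CM; not a corollary; Q11.4-sentence-2 already refuted in dim ≥ 3. [cite: Shimura1998, §14.3 Prop. 5, p. 104] -/
theorem exists_principal_xor_type_twentyOne [IsCMField K] [IsCyclotomicExtension {21} ℚ K] (hζ : IsPrimitiveRoot ζ 21)
    (Φ : CMType K) {𝔣₀ : Ideal (𝓞 (maximalRealSubfield K))}
    (h𝔣₀ : 𝔣₀.map (algebraMap (𝓞 (maximalRealSubfield K)) (𝓞 K)) = Ideal.span {hζ.toInteger ^ 17 * (1 - hζ.toInteger ^ 7) * (1 - hζ.toInteger ^ 1)}) :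
    Xor (∃ ζ' : K, IsCMField.complexConj K ζ' = -ζ' ∧ (∀ φ : Φ.1, 0 < (φ.1 ζ').im) ∧
          CMTypeLattice.IsOfType (1 : (FractionalIdeal (𝓞 K)⁰ K)ˣ) ζ' ⊤)
      (∃ ζ' : K, IsCMField.complexConj K ζ' = -ζ' ∧ (∀ φ : Φ.1, 0 < (φ.1 ζ').im) ∧
          CMTypeLattice.IsOfType (1 : (FractionalIdeal (𝓞 K)⁰ K)ˣ) ζ' 𝔣₀) := by
  have hg : Nat.totient 21 = 2 * (5 + 1) := by decide
  refine exists_principal_xor_exists_type hζ hg adm_twentyOne Φ h𝔣₀ (norm_realUnits_pos_twentyOne hζ)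
    (exists_units_sign_eq_twentyOne hζ Φ) ?_
  rw [twistSet_twentyOne, Summit.HodgeConjecture.Ring2WeilCoverage.CMTypeSetOddPositions.nodd_twentyOne_eq]
  have hS := isCMTypeSet_residueFilter hζ Φ
  have hN : IsCMTypeSet 21 ({1, 4, 8, 11, 16, 19} : Finset (ZMod 21)) := by decide
  have hX : IsCMTypeSet 21 ({2, 4, 11, 13, 16, 20} : Finset (ZMod 21)) := by decide
  have h := card_inter_add_card_inter_eq hS hN hX
  have hd : (({1, 4, 8, 11, 16, 19} : Finset (ZMod 21)) \ ({2, 4, 11, 13, 16, 20} : Finset (ZMod 21))).card = 3 := by decide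
  omega

end Level21

section Level28

/-- the residue set `S_Φ` read at level `28`. -/
local notation3 (prettyPrint := false) "SΦ[" Φ "," z "]" =>
  (Finset.univ.filter fun t : ZMod 28 => ∃ σ ∈ (Φ : CMType K).1, σ (z : K) = 𝐞 t)

/-- part 48's twisted sign set `X_π` at level `28` (`n := 28`). -/
local notation3 (prettyPrint := false) "Xtw28 " x:max =>
  (Finset.univ.filter fun t : ZMod 28 => t.val.Coprime 28 ∧
    ¬ ((28 < (x : ℕ × ℕ × ℕ).1 * ZMod.val t % (2 * 28) ↔ 28 < (x : ℕ × ℕ × ℕ).2.1 * ZMod.val t % (2 * 28)) ↔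
      Even (Finset.card (Finset.filter (fun s : ZMod 28 => s.val.Coprime 28 ∧ s.val < t.val) Finset.univ))))

/-- the census's `N_odd` at level `28` (part 5). -/
local notation3 (prettyPrint := false) "Nodd28" =>
  (Finset.univ.filter fun t : ZMod 28 => t.val.Coprime 28 ∧
    Even (Finset.card (Finset.filter (fun s : ZMod 28 => s.val.Coprime 28 ∧ s.val < t.val) Finset.univ)))

/-- **`N_odd(28) = [1, 5, 11, 15, 19, 25]`** (`decide`). [folklore] -/
theorem nodd_twentyEight_eq : Nodd28 = ({1, 5, 11, 15, 19, 25} : Finset (ZMod 28)) := by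
  decide

/-! #### Level `28`, the type `𝔣₀` with `𝔬𝔣₀ = (π)`, `π = ζ^25(1 − ζ^4)(1 − ζ^2)` (`ζ^4` a primitive `7`-th root of unity: `(π) = (1 − ζ^4)`, `(π)^6 = (7)`) -/

/-- the semi-admissibility of `x = (4, 2, 25)` at level `28` (`28 ∤ 4, 2`; `2·25 + 4 + 2 ≡ 0 (mod 56)`). [folklore] -/
theorem adm_twentyEight : ¬ 28 ∣ ((4, 2, 25) : ℕ × ℕ × ℕ).1 ∧ ¬ 28 ∣ ((4, 2, 25) : ℕ × ℕ × ℕ).2.1 ∧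
    (2 * ((4, 2, 25) : ℕ × ℕ × ℕ).2.2 + ((4, 2, 25) : ℕ × ℕ × ℕ).1 + ((4, 2, 25) : ℕ × ℕ × ℕ).2.1) % (2 * 28) = 0 := by
  decide

/-- **The twisted sign set at level `28` for `π = ζ^25(1 − ζ^4)(1 − ζ^2)`: `X_π = N_odd ∆ A_π = [3, 11, 15, 19, 23, 27]`** (`A_π = [1, 3, 5, 23, 25, 27]`, `|A_π|/2 = 3`;
`decide`).
research route conditional on HC_CM; not a corollary; Q11.4-sentence-2 already refuted in dim ≥ 3. [folklore] -/
theorem twistSet_twentyEight : Xtw28 ((4, 2, 25) : ℕ × ℕ × ℕ) = ({3, 11, 15, 19, 23, 27} : Finset (ZMod 28)) := by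
  decide

/-- **A type `𝔣₀ ⊆ 𝓞 K⁺` with `𝔬𝔣₀ = (π)`, `π = ζ^25(1 − ζ^4)(1 − ζ^2)`, EXISTS** (part 48 `exists_ideal_map_eq_span_gen`).
research route conditional on HC_CM; not a corollary; Q11.4-sentence-2 already refuted in dim ≥ 3. [cite: Shimura1998, §14.3, p. 103] -/
theorem exists_type_ideal_twentyEight [IsCMField K] (hζ : IsPrimitiveRoot ζ 28) :
    ∃ 𝔣₀ : Ideal (𝓞 (maximalRealSubfield K)),
      𝔣₀.map (algebraMap (𝓞 (maximalRealSubfield K)) (𝓞 K)) = Ideal.span {hζ.toInteger ^ 25 * (1 - hζ.toInteger ^ 4) * (1 - hζ.toInteger ^ 2)} :=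
  exists_ideal_map_eq_span_gen (x := ((4, 2, 25) : ℕ × ℕ × ℕ)) hζ adm_twentyEight

omit [NumberField K] in
/-- **`(𝔬𝔣₀)^6 = (7)`** for the type `𝔣₀` with `𝔬𝔣₀ = (π)`, `π = ζ^25(1 − ζ^4)(1 − ζ^2)`: `(π) = (1 − ζ^4)` (the factors `ζ^25`,
`1 − ζ^2` are units, part 13) and `(1 − ζ^4)^6 = (7)` (part 48c, `ζ^4` a primitive `7`-th root of unity) — so
`N(𝔬𝔣₀) = 7^2`, `N_{K⁺/ℚ}(𝔣₀) = 7^1`: a polarisation of type `𝔣₀` on `ℂ^Φ/Φ(ℤ[ζ_28])` has degree `7`.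
research route conditional on HC_CM; not a corollary; Q11.4-sentence-2 already refuted in dim ≥ 3. [cite: Washington1997, Lemma 1.4, Prop. 2.8] -/
theorem map_type_pow_twentyEight (hζ : IsPrimitiveRoot ζ 28) {𝔣₀ : Ideal (𝓞 (maximalRealSubfield K))}
    (h𝔣₀ : 𝔣₀.map (algebraMap (𝓞 (maximalRealSubfield K)) (𝓞 K)) = Ideal.span {hζ.toInteger ^ 25 * (1 - hζ.toInteger ^ 4) * (1 - hζ.toInteger ^ 2)}) :
    𝔣₀.map (algebraMap (𝓞 (maximalRealSubfield K)) (𝓞 K)) ^ 6 = Ideal.span {(7 : 𝓞 K)} := by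
  have hη : IsPrimitiveRoot (ζ ^ 4) 7 := hζ.pow (by norm_num) (by norm_num)
  have hηint : hη.toInteger = hζ.toInteger ^ 4 := RingOfIntegers.ext (by simp [IsPrimitiveRoot.toInteger])
  have hu1 : IsUnit (hζ.toInteger ^ 25 : 𝓞 K) := (hζ.toInteger_isPrimitiveRoot.isUnit (by norm_num)).pow 25
  have hu2 : IsUnit (1 - hζ.toInteger ^ 2 : 𝓞 K) := isUnit_one_sub_toInteger_pow hζ (by decide) (by decide +kernel)
  rw [h𝔣₀, Ideal.span_singleton_mul_right_unit hu2, Ideal.span_singleton_mul_left_unit hu1, ← hηint]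
  exact span_one_sub_pow_eq_seven hη

open scoped Classical in
/-- **CENSUS ROW `(ℚ(ζ_28), ℚ(√−7))` (a NO row for principal polarisations) — the RAMIFIED TYPE EXISTS: for every CM type `Φ`
of `ℚ(ζ_28)` balanced for `N_K = [3, 5, 13, 17, 19, 27]` (the Weil signature `(3,3)` on `K = ℚ(√−7)`) and every type `𝔣₀` with
`𝔬𝔣₀ = (π)`, `π = ζ^25(1 − ζ^4)(1 − ζ^2)`, the principal CM torus `ℂ^Φ/Φ(ℤ[ζ_28])` CARRIES a `Φ`-positive divisor `X_ζ′` of type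
`(K; Φ; 𝔣₀)`** — `ζ′^ρ = −ζ′`, `Im φ(ζ′) > 0` on `Φ`, `IsOfType 1 ζ′ 𝔣₀` [Sh98 §14.3 Prop. 4: a polarisation whose `φ_X` is the
`𝔬𝔣₀`-multiplication, of degree `7`].  Proof: part 48 `exists_type_of_even` + THEOREM L (ii) at `28` + the residue count
`|S_Φ ∩ X_π| ≡ |X_π ∖ N_K| + g/2 = 3 + 3 ≡ 0`.
research route conditional on HC_CM; not a corollary; Q11.4-sentence-2 already refuted in dim ≥ 3. [cite: Shimura1998, §14.3 Prop. 4–5, pp. 103–104] -/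
theorem exists_type_twentyEight_sqrt_neg_seven [IsCMField K] [IsCyclotomicExtension {28} ℚ K] (hζ : IsPrimitiveRoot ζ 28)
    (Φ : CMType K) (hbal : 2 * (SΦ[Φ, ζ] ∩ ({3, 5, 13, 17, 19, 27} : Finset (ZMod 28))).card = (SΦ[Φ, ζ]).card)
    {𝔣₀ : Ideal (𝓞 (maximalRealSubfield K))}
    (h𝔣₀ : 𝔣₀.map (algebraMap (𝓞 (maximalRealSubfield K)) (𝓞 K)) = Ideal.span {hζ.toInteger ^ 25 * (1 - hζ.toInteger ^ 4) * (1 - hζ.toInteger ^ 2)}) :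
    ∃ ζ' : K, IsCMField.complexConj K ζ' = -ζ' ∧ (∀ φ : Φ.1, 0 < (φ.1 ζ').im) ∧
        CMTypeLattice.IsOfType (1 : (FractionalIdeal (𝓞 K)⁰ K)ˣ) ζ' 𝔣₀ := by
  have hg : Nat.totient 28 = 2 * (5 + 1) := by decide
  refine exists_type_of_even hζ hg adm_twentyEight Φ h𝔣₀ (exists_units_sign_eq_twentyEight hζ Φ) ?_
  rw [twistSet_twentyEight]
  have hS := isCMTypeSet_residueFilter hζ Φ
  have hX : IsCMTypeSet 28 ({3, 11, 15, 19, 23, 27} : Finset (ZMod 28)) := by decide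
  have hNK : IsCMTypeSet 28 ({3, 5, 13, 17, 19, 27} : Finset (ZMod 28)) := by decide
  have h1 := card_inter_mod_two_eq hS hX hNK
  have h2 := two_mul_card_eq_card_units hS
  have hU : (Finset.univ.filter fun t : ZMod 28 => t.val.Coprime 28).card = 12 := by decide
  have h3 : (({3, 11, 15, 19, 23, 27} : Finset (ZMod 28)) \ ({3, 5, 13, 17, 19, 27} : Finset (ZMod 28))).card = 3 := by decide
  rw [Nat.even_iff]
  omega

open scoped Classical in
/-- **CENSUS ROW `(ℚ(ζ_28), ℚ(√−7))`, headline form: there is a type `𝔣₀ ⊆ 𝓞 K⁺` with `(𝔬𝔣₀)^6 = (7)` such that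
`ℂ^Φ/Φ(ℤ[ζ_28])` carries a `Φ`-positive divisor of type `(K; Φ; 𝔣₀)`** for every `K`-balanced CM type `Φ`, `K = ℚ(√−7)`
(polarisation degree `7`; the census's NO row gets an explicit NON-principal polarisation).
research route conditional on HC_CM; not a corollary; Q11.4-sentence-2 already refuted in dim ≥ 3. [cite: Shimura1998, §14.3 Prop. 4–5, pp. 103–104] -/
theorem exists_ramifiedType_twentyEight_sqrt_neg_seven [IsCMField K] [IsCyclotomicExtension {28} ℚ K]
    (hζ : IsPrimitiveRoot ζ 28) (Φ : CMType K) (hbal : 2 * (SΦ[Φ, ζ] ∩ ({3, 5, 13, 17, 19, 27} : Finset (ZMod 28))).card = (SΦ[Φ, ζ]).card) :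
    ∃ 𝔣₀ : Ideal (𝓞 (maximalRealSubfield K)),
      𝔣₀.map (algebraMap (𝓞 (maximalRealSubfield K)) (𝓞 K)) ^ 6 = Ideal.span {(7 : 𝓞 K)} ∧
      ∃ ζ' : K, IsCMField.complexConj K ζ' = -ζ' ∧ (∀ φ : Φ.1, 0 < (φ.1 ζ').im) ∧
        CMTypeLattice.IsOfType (1 : (FractionalIdeal (𝓞 K)⁰ K)ˣ) ζ' 𝔣₀ := by
  obtain ⟨𝔣₀, h𝔣₀⟩ := exists_type_ideal_twentyEight hζ
  exact ⟨𝔣₀, map_type_pow_twentyEight hζ h𝔣₀, exists_type_twentyEight_sqrt_neg_seven hζ Φ hbal h𝔣₀⟩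

open scoped Classical in
/-- **Row `(ℚ(ζ_28), ℚ(i))` (a YES row for principal polarisations) does NOT carry the ramified type**: for `Φ` balanced
for `N_K = [3, 11, 15, 19, 23, 27]` (`K = ℚ(i)`) there is NO `Φ`-positive divisor of type `𝔣₀`, `𝔬𝔣₀ = (π)`, `π = ζ^25(1 − ζ^4)(1 − ζ^2)` —
THEOREM L (i) at `28` + the odd count `|S_Φ ∩ X_π| ≡ 0 + 3` (part 48 `not_exists_type_of_norm_pos_of_odd`).
research route conditional on HC_CM; not a corollary; Q11.4-sentence-2 already refuted in dim ≥ 3. [cite: Shimura1998, §14.3 Prop. 5, p. 104] -/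
theorem not_exists_type_twentyEight_sqrt_neg_one [IsCMField K] [IsCyclotomicExtension {28} ℚ K] (hζ : IsPrimitiveRoot ζ 28)
    (Φ : CMType K) (hbal : 2 * (SΦ[Φ, ζ] ∩ ({3, 11, 15, 19, 23, 27} : Finset (ZMod 28))).card = (SΦ[Φ, ζ]).card)
    {𝔣₀ : Ideal (𝓞 (maximalRealSubfield K))}
    (h𝔣₀ : 𝔣₀.map (algebraMap (𝓞 (maximalRealSubfield K)) (𝓞 K)) = Ideal.span {hζ.toInteger ^ 25 * (1 - hζ.toInteger ^ 4) * (1 - hζ.toInteger ^ 2)}) :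
    ¬ ∃ ζ' : K, IsCMField.complexConj K ζ' = -ζ' ∧ (∀ φ : Φ.1, 0 < (φ.1 ζ').im) ∧
        CMTypeLattice.IsOfType (1 : (FractionalIdeal (𝓞 K)⁰ K)ˣ) ζ' 𝔣₀ := by
  have hg : Nat.totient 28 = 2 * (5 + 1) := by decide
  refine not_exists_type_of_norm_pos_of_odd hζ hg adm_twentyEight Φ h𝔣₀ (norm_realUnits_pos_twentyEight hζ) ?_
  rw [twistSet_twentyEight]
  have hS := isCMTypeSet_residueFilter hζ Φ
  have hX : IsCMTypeSet 28 ({3, 11, 15, 19, 23, 27} : Finset (ZMod 28)) := by decide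
  have hNK : IsCMTypeSet 28 ({3, 11, 15, 19, 23, 27} : Finset (ZMod 28)) := by decide
  have h1 := card_inter_mod_two_eq hS hX hNK
  have h2 := two_mul_card_eq_card_units hS
  have hU : (Finset.univ.filter fun t : ZMod 28 => t.val.Coprime 28).card = 12 := by decide
  have h3 : (({3, 11, 15, 19, 23, 27} : Finset (ZMod 28)) \ ({3, 11, 15, 19, 23, 27} : Finset (ZMod 28))).card = 0 := by decide
  rw [Nat.odd_iff]
  omega

open scoped Classical in
/-- **DICHOTOMY AT LEVEL `28`: every one of the `2^6` CM types `Φ` of `ℚ(ζ_28)` makes `ℂ^Φ/Φ(ℤ[ζ_28])` carry EITHER an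
`ι`-compatible principal polarisation OR a `Φ`-positive divisor of the ramified type `𝔣₀` (`𝔬𝔣₀ = (π)`, `π = ζ^25(1 − ζ^4)(1 − ζ^2)`),
NEVER BOTH** — `|N_odd ∖ X_π| = |A_π|/2 = 3` is odd (equivalently `N_{K⁺/ℚ}(π) < 0`), THEOREM L (i)/(ii) at `28`, part 48
`exists_principal_xor_exists_type`.
research route conditional on HC_CM; not a corollary; Q11.4-sentence-2 already refuted in dim ≥ 3. [cite: Shimura1998, §14.3 Prop. 5, p. 104] -/
theorem exists_principal_xor_type_twentyEight [IsCMField K] [IsCyclotomicExtension {28} ℚ K] (hζ : IsPrimitiveRoot ζ 28)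
    (Φ : CMType K) {𝔣₀ : Ideal (𝓞 (maximalRealSubfield K))}
    (h𝔣₀ : 𝔣₀.map (algebraMap (𝓞 (maximalRealSubfield K)) (𝓞 K)) = Ideal.span {hζ.toInteger ^ 25 * (1 - hζ.toInteger ^ 4) * (1 - hζ.toInteger ^ 2)}) :
    Xor (∃ ζ' : K, IsCMField.complexConj K ζ' = -ζ' ∧ (∀ φ : Φ.1, 0 < (φ.1 ζ').im) ∧
          CMTypeLattice.IsOfType (1 : (FractionalIdeal (𝓞 K)⁰ K)ˣ) ζ' ⊤)
      (∃ ζ' : K, IsCMField.complexConj K ζ' = -ζ' ∧ (∀ φ : Φ.1, 0 < (φ.1 ζ').im) ∧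
          CMTypeLattice.IsOfType (1 : (FractionalIdeal (𝓞 K)⁰ K)ˣ) ζ' 𝔣₀) := by
  have hg : Nat.totient 28 = 2 * (5 + 1) := by decide
  refine exists_principal_xor_exists_type hζ hg adm_twentyEight Φ h𝔣₀ (norm_realUnits_pos_twentyEight hζ)
    (exists_units_sign_eq_twentyEight hζ Φ) ?_
  rw [twistSet_twentyEight, nodd_twentyEight_eq]
  have hS := isCMTypeSet_residueFilter hζ Φ
  have hN : IsCMTypeSet 28 ({1, 5, 11, 15, 19, 25} : Finset (ZMod 28)) := by decide
  have hX : IsCMTypeSet 28 ({3, 11, 15, 19, 23, 27} : Finset (ZMod 28)) := by decide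
  have h := card_inter_add_card_inter_eq hS hN hX
  have hd : (({1, 5, 11, 15, 19, 25} : Finset (ZMod 28)) \ ({3, 11, 15, 19, 23, 27} : Finset (ZMod 28))).card = 3 := by decide
  omega

end Level28

end Summit.HodgeConjecture.Ring2WeilCoverage.RamifiedTypesLevels21and28

end
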